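import Literature.Computability.MetaComplexity.FpLinearSystems
import Literature.Computability.MetaComplexity.FregeMod
import Literature.Computability.MetaComplexity.GaussianWidth
import Literature.Computability.MetaComplexity.TseitinDepthFregeTransfer
import Mathlib.Data.List.Sublists
import Mathlib.Data.Nat.Choose.Bounds
import HarnessLib

/-!
# Parity DNFs of linear equations over `𝔽₂`

Groundwork for the bounded-depth Frege UPPER bound through Gaussian width
(`GaussianWidthDepthFregeUpperBound.lean`: a system over `𝔽₂` of Gaussian width `≤ w` has a
constant-depth `textbookFrege` refutation of its parity CNF `sumEncoding 1 E` of size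
`poly(m) · n^{O(w+ℓ)}` — the folklore simulation "write each derived parity as a DNF and derive
each XOR step by a case analysis over its `≤ 2w` variables"). Here:

* `canonicalDNF V P` — the canonical DNF of a constraint `P` on the duplicate-free variable list
  `V` (one full term per satisfying assignment), dual to `canonicalCNF` of `FpLinearSystems.lean`,
  with its semantics `evalDNF_canonicalDNF`;
* `TextbookFrege.termOf`, `ofDNF_eq_disjList` — `PropForm.ofDNF` renders a DNF as the list
  disjunction (`TextbookFrege.disjList`) of the list conjunctions (`conjList`) of its literal
  formulas (`KrajicekRamsey.litOf`), so that the size / disjunct-depth / variable bookkeeping of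
  `FregeBounded.lean` applies (`size_ofDNF_le`, `dd_ofDNF_le`, `mem_vars_ofDNF`);
* `parityForm q` — the parity DNF of an equation `q : LinEqMod 2 n` over the Boolean variables
  `eqVars 1 q` of the sum-encoding with block size `1` (variable `i` for `y_i`): its value is
  `[q holds at blockVals σ]` (`eval_parityForm`), it mentions only the variables of `supp q`
  (`mem_vars_parityForm`), has size `≤ 2^{|supp q|} (3 |supp q| + 2) + 1`, disjunct depth `≤ 3`,
  and the contradiction `0 = 1` renders as `⊥` (`parityForm_zero_one`);
* `card_smallEqs_le` — there are at most `2 (n+1)^W` equations with at most `W` variables (the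
  deduplication count of the simulation).

References: E. Ben-Sasson, R. Impagliazzo, *Random CNF's are hard for the polynomial calculus*,
Comput. Complexity 19 (2010) (Gaussian width); N. Galesi, D. Itsykson, A. Riazanov, A. Sofronova,
*Bounded-depth Frege complexity of Tseitin formulas for all graphs*, APAL 174 (2023), §4 (the
upper bound for Tseitin formulas by brute-force derivations of local parity steps). The DNF
bookkeeping is folklore.
-/

namespace Literature.Computability.MetaComplexity

open Complexity Complexity.PropForm TextbookFrege KrajicekRamsey Finset

/-! ### The canonical DNF of a Boolean constraint -/

/-- The canonical DNF of a constraint on the duplicate-free list of variables `V`, the constraint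
being given on the set of variables that are `true`: for every sub-list `S` of `V` SATISFYING the
constraint, the term `⋀_{v ∈ V} v^{[v ∈ S]}` made true exactly by the indicator assignment of `S`
(dual to `canonicalCNF`). [Beck 2017, Def. 5.6 (trivial CNF representation), dualised] [folklore] -/
def canonicalDNF (V : List ℕ) (P : List ℕ → Bool) : CNF ℕ :=
  (V.sublists.filter fun S => P S).map fun S => V.map fun v => (v, decide (v ∈ S))

/-- The term of the canonical DNF indexed by `S` is true under `σ` iff `σ` restricted to `V` is
the indicator of `S`. [folklore] -/
theorem all_canonicalTerm_eq_true_iff {V S : List ℕ} (σ : ℕ → Bool) :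
    (V.map fun v => (v, decide (v ∈ S))).all (Literal.eval σ) = true ↔
      ∀ v ∈ V, σ v = decide (v ∈ S) := by
  simp only [List.all_eq_true, List.mem_map, forall_exists_index, and_imp,
    forall_apply_eq_imp_iff₂, Literal.eval]
  refine forall₂_congr fun v _ => ?_
  cases σ v <;> by_cases h : v ∈ S <;> simp [h]

/-- **Semantics of the canonical DNF**: on a duplicate-free variable list `V`, the canonical DNF
of `P` is true under `σ` iff `P` holds of the set of `V`-variables made true by `σ`. [folklore] -/
theorem evalDNF_canonicalDNF {V : List ℕ} (hV : V.Nodup) (P : List ℕ → Bool) (σ : ℕ → Bool) :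
    (canonicalDNF V P).evalDNF σ = P (V.filter fun v => σ v) := by
  set T := V.filter fun v => σ v with hT
  have hTσ : ∀ v ∈ V, σ v = decide (v ∈ T) := fun v hv => by
    by_cases hσ : σ v = true <;> simp [hT, List.mem_filter, hv, hσ]
  rw [Bool.eq_iff_iff, CNF.evalDNF, List.any_eq_true]
  constructor
  · rintro ⟨c, hc, hcσ⟩
    obtain ⟨S, hS, rfl⟩ := List.mem_map.1 hc
    obtain ⟨hSsub, hSP⟩ := List.mem_filter.1 hS
    rw [List.mem_sublists] at hSsub
    have hall : ∀ v ∈ V, σ v = decide (v ∈ S) := (all_canonicalTerm_eq_true_iff σ).1 hcσ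
    have hTS : T = S := by
      rw [hT, ← filter_mem_eq_of_sublist hSsub hV]
      exact List.filter_congr fun v hv => by rw [hall v hv]
    rw [hTS]; exact hSP
  · intro hP
    refine ⟨V.map fun v => (v, decide (v ∈ T)), List.mem_map.2 ⟨T, List.mem_filter.2
      ⟨List.mem_sublists.2 List.filter_sublist, hP⟩, rfl⟩, ?_⟩
    exact (all_canonicalTerm_eq_true_iff σ).2 hTσ

/-- A canonical DNF on `V` has at most `2^{|V|}` terms. [folklore] -/
theorem length_canonicalDNF_le (V : List ℕ) (P : List ℕ → Bool) :
    (canonicalDNF V P).length ≤ 2 ^ V.length := by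
  rw [canonicalDNF, List.length_map, ← List.length_sublists]
  exact List.length_filter_le _ _

/-- Every term of a canonical DNF lists all the variables of `V` once. [folklore] -/
theorem length_of_mem_canonicalDNF {V : List ℕ} {P : List ℕ → Bool} {c : Clause ℕ}
    (h : c ∈ canonicalDNF V P) : c.length = V.length := by
  obtain ⟨S, -, rfl⟩ := List.mem_map.1 h
  simp

/-- The variables of a term of a canonical DNF are those of `V`. [folklore] -/
theorem fst_mem_of_mem_canonicalDNF {V : List ℕ} {P : List ℕ → Bool} {c : Clause ℕ}
    (h : c ∈ canonicalDNF V P) {l : Literal ℕ} (hl : l ∈ c) : l.1 ∈ V := by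
  obtain ⟨S, -, rfl⟩ := List.mem_map.1 h
  obtain ⟨v, hv, rfl⟩ := List.mem_map.1 hl
  exact hv

/-! ### `PropForm.ofDNF` through `disjList` / `conjList` -/

namespace TextbookFrege

/-- The formula of a DNF term as rendered by `PropForm.ofDNF`: `l₁ ∧ (l₂ ∧ (⋯ ∧ ⊤))`. [folklore] -/
def termOf (c : Clause ℕ) : PropForm ℕ :=
  conjList (c.map litOf)

/-- `PropForm.ofDNF` renders a DNF as the list disjunction of its term formulas. [folklore] -/
theorem ofDNF_eq_disjList (φ : CNF ℕ) : PropForm.ofDNF φ = disjList (φ.map termOf) := by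
  induction φ with
  | nil => rfl
  | cons c φ ih =>
    rw [List.map_cons, disjList_cons, ← ih]
    simp only [PropForm.ofDNF, List.foldr_cons]
    congr 1
    rw [termOf, conjList, List.foldr_map]
    rfl

/-- A literal formula has size at most `2`. [folklore] -/
theorem size_litOf_le (l : Literal ℕ) : (litOf l).size ≤ 2 := by
  unfold litOf; split_ifs <;> simp [size]

/-- The variable of a literal formula. [folklore] -/
theorem mem_vars_litOf {l : Literal ℕ} {x : ℕ} (h : x ∈ (litOf l).vars) : x = l.1 := by
  unfold litOf at h; split_ifs at h <;> simpa [PropForm.vars] using h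

/-- The value of a literal formula. [folklore] -/
theorem eval_litOf' (σ : ℕ → Bool) (l : Literal ℕ) : (litOf l).eval σ = l.eval σ := by
  unfold litOf Literal.eval
  rcases l with ⟨x, b⟩
  cases b <;> cases h : σ x <;> simp [PropForm.eval, h]

/-- Size of a term formula: at most `3 |c| + 1`. [folklore] -/
theorem size_termOf_le (c : Clause ℕ) : (termOf c).size ≤ 3 * c.length + 1 := by
  rw [termOf, size_conjList_eq_msum]
  suffices h : msum (c.map litOf) ≤ 3 * c.length by omega
  induction c with
  | nil => simp
  | cons l c ih =>
    rw [List.map_cons, msum_cons, List.length_cons]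
    have := size_litOf_le l
    omega

/-- Disjunct depth of a term formula: at most `3`. [folklore] -/
theorem dd_termOf_le (c : Clause ℕ) : (termOf c).dd ≤ 3 :=
  dd_conjList_le (p := 1) fun X hX => by
    obtain ⟨l, -, rfl⟩ := List.mem_map.1 hX
    exact dd_litOf_le l

/-- Variables of a list conjunction are variables of members. [folklore] -/
theorem mem_vars_conjList {M : List (PropForm ℕ)} {x : ℕ} (h : x ∈ (conjList M).vars) :
    ∃ A ∈ M, x ∈ A.vars := by
  induction M with
  | nil => simp [PropForm.vars] at h
  | cons A M ih =>
    rw [conjList_cons] at h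
    simp only [PropForm.vars, Finset.mem_union] at h
    rcases h with h | h
    · exact ⟨A, List.mem_cons_self, h⟩
    · obtain ⟨B, hB, hx⟩ := ih h
      exact ⟨B, List.mem_cons_of_mem _ hB, hx⟩

/-- Variables of a list disjunction are variables of members. [folklore] -/
theorem mem_vars_disjList {L : List (PropForm ℕ)} {x : ℕ} (h : x ∈ (disjList L).vars) :
    ∃ A ∈ L, x ∈ A.vars := by
  induction L with
  | nil => simp [PropForm.vars] at h
  | cons A L ih =>
    rw [disjList_cons] at h
    simp only [PropForm.vars, Finset.mem_union] at h
    rcases h with h | h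
    · exact ⟨A, List.mem_cons_self, h⟩
    · obtain ⟨B, hB, hx⟩ := ih h
      exact ⟨B, List.mem_cons_of_mem _ hB, hx⟩

/-- Variables of a term formula are variables of its literals. [folklore] -/
theorem mem_vars_termOf {c : Clause ℕ} {x : ℕ} (h : x ∈ (termOf c).vars) : ∃ l ∈ c, l.1 = x := by
  obtain ⟨A, hA, hx⟩ := mem_vars_conjList h
  obtain ⟨l, hl, rfl⟩ := List.mem_map.1 hA
  exact ⟨l, hl, (mem_vars_litOf hx).symm⟩

/-- **Size of a DNF formula**: with `k`-bounded terms, `|ofDNF φ| ≤ |φ| (3k + 2) + 1`. [folklore] -/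
theorem size_ofDNF_le {φ : CNF ℕ} {k : ℕ} (hk : ∀ c ∈ φ, c.length ≤ k) :
    (PropForm.ofDNF φ).size ≤ φ.length * (3 * k + 2) + 1 := by
  rw [ofDNF_eq_disjList, size_disjList_eq_msum]
  have h := msum_le_length_mul (L := φ.map termOf) (W := 3 * k + 2) fun X hX => by
    obtain ⟨c, hc, rfl⟩ := List.mem_map.1 hX
    have h1 := size_termOf_le c
    have h2 := hk c hc
    nlinarith
  rw [List.length_map] at h
  omega

/-- **Disjunct depth of a DNF formula**: at most `3`. [folklore] -/
theorem dd_ofDNF_le (φ : CNF ℕ) : (PropForm.ofDNF φ).dd ≤ 3 := by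
  rw [ofDNF_eq_disjList]
  exact dd_disjList_le fun X hX => by
    obtain ⟨c, -, rfl⟩ := List.mem_map.1 hX
    exact dd_termOf_le c

/-- Disjunct depth of a negated DNF formula: at most `5`. [folklore] -/
theorem dd_neg_ofDNF_le (φ : CNF ℕ) : (neg (PropForm.ofDNF φ)).dd ≤ 5 := by
  rw [ofDNF_eq_disjList]
  exact dd_neg_disjList_le (p := 3) fun X hX => by
    obtain ⟨c, -, rfl⟩ := List.mem_map.1 hX
    exact dd_termOf_le c

/-- **Variables of a DNF formula** are variables of its literals. [folklore] -/
theorem mem_vars_ofDNF {φ : CNF ℕ} {x : ℕ} (h : x ∈ (PropForm.ofDNF φ).vars) :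
    ∃ c ∈ φ, ∃ l ∈ c, l.1 = x := by
  rw [ofDNF_eq_disjList] at h
  obtain ⟨A, hA, hx⟩ := mem_vars_disjList h
  obtain ⟨c, hc, rfl⟩ := List.mem_map.1 hA
  obtain ⟨l, hl, rfl⟩ := mem_vars_termOf hx
  exact ⟨c, hc, l, hl, rfl⟩

end TextbookFrege

/-! ### The parity DNF of an equation over `𝔽₂` -/

section Parity

variable {n : ℕ}

/-- With block size `1` the variables of an equation are (the indices of) its support. [folklore] -/
theorem mem_eqVars_one {q : LinEqMod 2 n} {v : ℕ} :
    v ∈ eqVars 1 q ↔ ∃ i ∈ q.supp, v = (i : ℕ) := by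
  rw [mem_eqVars]
  simp [mem_encBlock]

/-- With block size `1` an equation has `|supp q|` variables. [folklore] -/
theorem length_eqVars_one (q : LinEqMod 2 n) : (eqVars 1 q).length = q.supp.card := by
  rw [length_eqVars, Nat.mul_one]

/-- The variables of an equation are indices `< n`. [folklore] -/
theorem lt_of_mem_eqVars_one {q : LinEqMod 2 n} {v : ℕ} (h : v ∈ eqVars 1 q) : v < n := by
  obtain ⟨i, -, rfl⟩ := mem_eqVars_one.1 h
  exact i.2

/-- **The parity DNF** of an equation `q : Σ_{j ∈ supp q} y_j = b` over `𝔽₂`: the canonical DNF,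
over the Boolean variables `j ∈ supp q` of the sum-encoding with block size `1`, of the assignments
of `supp q` of parity `b` (`2^{|supp q| - 1}` full terms). This is the formula by which a line of
a Gaussian refutation is represented inside a bounded-depth Frege proof.
[Galesi–Itsykson–Riazanov–Sofronova 2023, §4 (representing parities of few variables by DNFs)]
[folklore] -/
def parityForm (q : LinEqMod 2 n) : PropForm ℕ :=
  PropForm.ofDNF (canonicalDNF (eqVars 1 q) (eqPred 1 q))

/-- **Semantics of the parity DNF**: it is true under `σ` iff the equation holds for the values
`y_j := [σ j]`. [folklore] -/
theorem eval_parityForm (q : LinEqMod 2 n) (σ : ℕ → Bool) :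
    (parityForm q).eval σ = decide (q.Holds (blockVals 2 1 n σ)) := by
  rw [parityForm, PropForm.eval_ofDNF, evalDNF_canonicalDNF (nodup_eqVars 1 q)]
  have h := eval_equationCNF 1 q σ
  rwa [equationCNF, eval_canonicalCNF (nodup_eqVars 1 q)] at h

/-- The parity DNF is true under `σ` iff the equation holds at the induced values. [folklore] -/
theorem eval_parityForm_eq_true_iff (q : LinEqMod 2 n) (σ : ℕ → Bool) :
    (parityForm q).eval σ = true ↔ q.Holds (blockVals 2 1 n σ) := by
  rw [eval_parityForm, decide_eq_true_eq]

/-- The parity DNF mentions only the variables of the support. [folklore] -/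
theorem mem_vars_parityForm {q : LinEqMod 2 n} {x : ℕ} (h : x ∈ (parityForm q).vars) :
    x ∈ eqVars 1 q := by
  obtain ⟨c, hc, l, hl, rfl⟩ := TextbookFrege.mem_vars_ofDNF h
  exact fst_mem_of_mem_canonicalDNF hc hl

/-- **Size of the parity DNF**: at most `2^{|supp q|} (3 |supp q| + 2) + 1`. [folklore] -/
theorem size_parityForm_le (q : LinEqMod 2 n) :
    (parityForm q).size ≤ 2 ^ q.supp.card * (3 * q.supp.card + 2) + 1 := by
  have h1 := TextbookFrege.size_ofDNF_le (φ := canonicalDNF (eqVars 1 q) (eqPred 1 q))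
    (k := q.supp.card) fun c hc => by rw [length_of_mem_canonicalDNF hc, length_eqVars_one]
  have h2 := length_canonicalDNF_le (eqVars 1 q) (eqPred 1 q)
  rw [length_eqVars_one] at h2
  exact h1.trans (by nlinarith)

/-- The size of the parity DNF is monotone in a bound on the support. [folklore] -/
theorem size_parityForm_le_of_le {q : LinEqMod 2 n} {W : ℕ} (h : q.supp.card ≤ W) :
    (parityForm q).size ≤ 2 ^ W * (3 * W + 2) + 1 := by
  refine (size_parityForm_le q).trans ?_
  have := Nat.pow_le_pow_right (show 0 < 2 by norm_num) h
  exact Nat.succ_le_succ (Nat.mul_le_mul this (by omega))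

/-- Disjunct depth of the parity DNF: at most `3`. [folklore] -/
theorem dd_parityForm_le (q : LinEqMod 2 n) : (parityForm q).dd ≤ 3 :=
  TextbookFrege.dd_ofDNF_le _

/-- Disjunct depth of the negated parity DNF: at most `5`. [folklore] -/
theorem dd_neg_parityForm_le (q : LinEqMod 2 n) : (neg (parityForm q)).dd ≤ 5 :=
  TextbookFrege.dd_neg_ofDNF_le _

/-- Alternation depth of the parity DNF: at most `3`. [folklore] -/
theorem altDepth_parityForm_le (q : LinEqMod 2 n) : (parityForm q).altDepth ≤ 3 :=
  altDepth_ofDNF_le _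

/-- Alternation depth of the negated parity DNF: at most `5`. [folklore] -/
theorem altDepth_neg_parityForm_le (q : LinEqMod 2 n) : (neg (parityForm q)).altDepth ≤ 5 := by
  have h2 := dd_neg_parityForm_le q
  rw [dd_neg] at h2
  simp only [altDepth, altDepthAux, show (0 : ℕ) ≠ 1 from by decide, if_false]
  exact h2

/-- **The contradiction renders as `⊥`**: the parity DNF of `0 = 1` has no terms. [folklore] -/
theorem parityForm_zero_one : parityForm ((0, 1) : LinEqMod 2 n) = PropForm.const false := by
  have hsupp : LinEqMod.supp ((0, 1) : LinEqMod 2 n) = ∅ := by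
    simp [LinEqMod.supp]
  have hvars : eqVars 1 ((0, 1) : LinEqMod 2 n) = [] := by
    simp [eqVars, hsupp]
  have hpred : eqPred 1 ((0, 1) : LinEqMod 2 n) [] = false := by
    simp [eqPred, hsupp]
  rw [parityForm, hvars]
  simp [canonicalDNF, hpred, PropForm.ofDNF]

end Parity

/-! ### Equations over `𝔽₂`: supports of sums, few small equations -/

section SmallEqs

variable {n : ℕ}

/-- The support of a sum is contained in the union of the supports. [folklore] -/
theorem LinEqMod.supp_add_subset {p : ℕ} (E F : LinEqMod p n) : (E + F).supp ⊆ E.supp ∪ F.supp := by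
  intro j hj
  rw [Finset.mem_union, LinEqMod.mem_supp, LinEqMod.mem_supp]
  rw [LinEqMod.mem_supp] at hj
  by_contra h
  push Not at h
  exact hj (by simp [Prod.fst_add, Pi.add_apply, h.1, h.2])

/-- Over `𝔽₂` an equation is determined by its support and its right-hand side. [folklore] -/
theorem LinEqMod.eq_of_supp_eq_two {E F : LinEqMod 2 n} (h1 : E.supp = F.supp) (h2 : E.2 = F.2) :
    E = F := by
  have h01 : ∀ b : ZMod 2, b = 0 ∨ b = 1 := by decide
  refine Prod.ext (funext fun j => ?_) h2
  have hj : (E.1 j ≠ 0) ↔ (F.1 j ≠ 0) := by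
    rw [← LinEqMod.mem_supp, ← LinEqMod.mem_supp, h1]
  rcases h01 (E.1 j) with hE | hE <;> rcases h01 (F.1 j) with hF | hF <;>
    simp_all

/-- The equations over `𝔽₂` in `n` unknowns with at most `W` variables. [folklore] -/
def smallEqs (n W : ℕ) : Finset (LinEqMod 2 n) :=
  univ.filter fun q => q.supp.card ≤ W

/-- Membership in `smallEqs`. [folklore] -/
theorem mem_smallEqs {W : ℕ} {q : LinEqMod 2 n} : q ∈ smallEqs n W ↔ q.supp.card ≤ W := by
  simp [smallEqs]

/-- A partial row sum of Pascal's triangle: `Σ_{s ≤ W} C(n, s) ≤ (n+1)^W`. [folklore] -/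
theorem sum_range_succ_choose_le_pow (n W : ℕ) : ∑ s ∈ range (W + 1), n.choose s ≤ (n + 1) ^ W := by
  induction W with
  | zero => simp
  | succ W ih =>
    rw [sum_range_succ, pow_succ]
    have h1 := Nat.choose_le_pow n (W + 1)
    have h2 : n ^ (W + 1) ≤ n * (n + 1) ^ W := by
      rw [pow_succ, mul_comm]
      exact Nat.mul_le_mul_left n (Nat.pow_le_pow_left (Nat.le_succ n) W)
    nlinarith

/-- The number of subsets of `Fin n` of size at most `W` is at most `(n+1)^W`. [folklore] -/
theorem card_filter_card_le_pow (n W : ℕ) :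
    ((univ : Finset (Fin n)).powerset.filter fun S => S.card ≤ W).card ≤ (n + 1) ^ W := by
  have hsub : ((univ : Finset (Fin n)).powerset.filter fun S => S.card ≤ W) ⊆
      (range (W + 1)).biUnion fun s => powersetCard s (univ : Finset (Fin n)) := by
    intro S hS
    rw [mem_filter] at hS
    rw [mem_biUnion]
    exact ⟨S.card, mem_range.2 (Nat.lt_succ_of_le hS.2), mem_powersetCard.2 ⟨subset_univ _, rfl⟩⟩
  refine (card_le_card hsub).trans ((card_biUnion_le).trans ?_)
  simp only [card_powersetCard, card_univ, Fintype.card_fin]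
  exact sum_range_succ_choose_le_pow n W

/-- **Few small equations**: at most `2 (n+1)^W` equations over `𝔽₂` in `n` unknowns have at most
`W` variables. (The deduplication bound of the Gaussian-width simulation.) [folklore] -/
theorem card_smallEqs_le (n W : ℕ) : (smallEqs n W).card ≤ 2 * (n + 1) ^ W := by
  classical
  set T := ((univ : Finset (Fin n)).powerset.filter fun S => S.card ≤ W) ×ˢ (univ : Finset (ZMod 2))
    with hT
  have hmaps : ∀ q ∈ smallEqs n W, (q.supp, q.2) ∈ T := fun q hq => by
    rw [hT, mem_product, mem_filter]
    exact ⟨⟨mem_powerset.2 (subset_univ _), mem_smallEqs.1 hq⟩, mem_univ _⟩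
  have hinj : Set.InjOn (fun q : LinEqMod 2 n => (q.supp, q.2)) (smallEqs n W) :=
    fun q _ q' _ h => by
      simp only [Prod.mk.injEq] at h
      exact LinEqMod.eq_of_supp_eq_two h.1 h.2
  calc (smallEqs n W).card ≤ T.card := card_le_card_of_injOn _ hmaps hinj
    _ = ((univ : Finset (Fin n)).powerset.filter fun S => S.card ≤ W).card * 2 := by
        rw [hT, card_product]; simp
    _ ≤ (n + 1) ^ W * 2 := Nat.mul_le_mul_right 2 (card_filter_card_le_pow n W)
    _ = 2 * (n + 1) ^ W := by ring

/-- A duplicate-free list of small equations is short. [folklore] -/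
theorem length_le_of_nodup_of_small {W : ℕ} {Λ : List (LinEqMod 2 n)} (hnd : Λ.Nodup)
    (hW : ∀ q ∈ Λ, q.supp.card ≤ W) : Λ.length ≤ 2 * (n + 1) ^ W := by
  classical
  rw [← List.toFinset_card_of_nodup hnd]
  refine (card_le_card fun q hq => ?_).trans (card_smallEqs_le n W)
  exact mem_smallEqs.2 (hW q (List.mem_toFinset.1 hq))

end SmallEqs

end Literature.Computability.MetaComplexity
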